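import Literature.MathematicalPhysics.QuantumFieldTheory.Balaban1983to89.B9Thm313WholeLeafRel
import Literature.MathematicalPhysics.QuantumFieldTheory.Balaban1983to89.B9Thm312WholeBlocksRel

/-!
# `Balaban1983to89.B9Thm313WholeLeafRelS` — [B9] Theorem 3.13 (p. 426) AS THE WHOLE PRINTED LEAF `B9.Thm313Printed` AT THE PINS OF THEOREM 3.12 — the
# row-21 leaf with the L² lines (3.46)₀,₁,₂ of 𝔊 PROVED INSIDE by the Schur test from the proved sup majorants

T. Bałaban, *Propagators for lattice gauge theories in a background field*, Commun. Math. Phys. **99** (1985) 389–434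
[`Balaban1985BackgroundPropagators`, "B9"]; [4] = T. Bałaban, *Propagators and renormalization transformations for lattice
gauge theories. II*, Commun. Math. Phys. **96** (1984) 223–250 [`Balaban1984PropagatorsII`].

statement-level skeleton of published theorems with citation tags; proofs where landed; nothing here is a claim about the
Yang–Mills mass gap

THE PRINTED LOCI are those of `…B9Thm313WholeLeafCoGlob` and `…B9Thm312WholeL2` (verbatim there); (3.153) p. 426: *"𝔊 = G₁ − G₁DRD*G₁ −
G₁Q*(QG₁Q*)⁻¹QG₁ = G₁𝔓* = 𝔓G₁"* (𝔊 symmetric with G₁); p. 398: *"we may always replace ∇_U by ∇\*_U, and vice versa"*.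

WHY THIS FILE (successor of `…B9Thm313WholeLeafRel.thm313Printed_of_stepRel`, same seat).  That leaf PROVES the three sup majorants of 𝔊, ∇_U𝔊,
𝔊∇\*_U (`GG_entry0∕1∕2_of_letters`) and DISPLAYS the whole L² block (3.46) of 𝔊.  By the Schur test from those majorants (`B9Thm312WholeL2.l2bd_entry0_of_sup`,
`l2bd_entry12_of_sup`), the symmetry of 𝔊 and the transposition (∇_U𝔊)ᵀ = 𝔊∇\*_U (letters `hsymGG`, `htrGG`), the scale transfer of p. 398 and n06-k's
relative L² co-readings `L2ReadsRel` of `GG.l2 0∕1∕2` (`hl2R`), the lines (3.46)₀,₁,₂ of 𝔊 are PROVED INSIDE (`l2line_of_blockBd_rel`); the residual keeps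
the lines (3.46)₃,₄,₅ and the Hölder block (3.43)–(3.45) of 𝔊 (whose reduction through (3.153) needs the letters of 𝔓 in those classes — not typed yet).

WHAT THIS FILE PROVES (one theorem — 0 `def`, 0 named fact, 0 sorry): ★ `thm313Printed_of_stepRelS` — conclusion and pins of row 21 unchanged; inputs =
those of `thm313Printed_of_stepRel` + `[DecidableEq Site]`, `hα0 : 0 ≦ α`, `hα1 : α < 1`, `hsymGG`, `htrGG`, `hl2R`; `hres` := the lines (3.46)ₙ, n ≧ 3, and
`Ineq343_345` of 𝔊.  Constants: the Schur lines at (m²·C_sup·L_c⁴, (1 − α)ρ′).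

HONEST SCOPE.  Nothing of print is asserted: every analytic input is a HYPOTHESIS of printed ∕ definitional shape.  Kernel-checked bookkeeping — NOT a
node discharge, NOT summit progress; one finite lattice at a time; nothing continuum, nothing about the mass gap.  Cell `pub-ymgap` (HUMAN RULING
D-0062), Track A node N06 [B9], N06-ASSIGNMENT v1 row 21 (bundle F7), seat `pub-ymgap-dag-n06-l` (g4), 2026-08-27.
-/

namespace Literature.MathematicalPhysics.QuantumFieldTheory.Balaban1983to89.B9Thm313WholeLeafRelS

open Literature.MathematicalPhysics.QuantumFieldTheory.Balaban1983to89
open Finset B6RandomWalk B6RandomWalkHom B9Thm34Ext B9Thm37GlueCor36 B11SectG B9SectDSup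
open B9Thm37AllNorms B9Thm37AllNormsInstances B9FromB6 B9FromB6ModelSignsOn B9SectBStepWhole B9Thm312Whole B9Thm312WholeLeaf
open B9Thm312WholeLeft B9Thm313Whole B9Thm313WholeLeft B9Thm312WholeLeafLeftGlob B9Ineq347CoReading B9SectCDiffDict B9CoRealizesRel
open B9Thm37Glue B9SectDL2Decay B9RWSums343Holder B9RWSumsReadsRel B9Ineq347 B9Thm312WholeClasses B9Thm312WholeL2 B9Thm312WholeBlocksRel
open B9Thm313WholeLeafRel

noncomputable section

section Family

variable {I : Type} {c35 : ℝ} {geo : I → B9.Geometry} {bg : I → B9.Backgrounds}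
variable [∀ i, Fintype (geo i).Site] [∀ i, DecidableEq (geo i).Site]
variable {X Y Z W : I → Type} [∀ i, Fintype (X i)] [∀ i, DecidableEq (X i)] [∀ i, Fintype (Y i)]
  [∀ i, Fintype (Z i)] [∀ i, Fintype (W i)]

omit [∀ i, Fintype (X i)] [∀ i, DecidableEq (X i)] [∀ i, Fintype (Y i)] [∀ i, Fintype (Z i)] [∀ i, Fintype (W i)]
  [∀ i, Fintype (geo i).Site] [∀ i, DecidableEq (geo i).Site] in
/-- Arithmetic of *"for α₀ sufficiently small"*: t ≧ 0 and m ≦ (2(t + 1))⁻¹ give tm ≦ ½. [folklore] -/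
private theorem small_aux₆ {t m : ℝ} (ht : 0 ≤ t) (hm : m ≤ (2 * (t + 1))⁻¹) : t * m ≤ 1 / 2 := by
  have hpos : 0 < 2 * (t + 1) := by linarith
  have h1 : t * m ≤ t * (2 * (t + 1))⁻¹ := mul_le_mul_of_nonneg_left hm ht
  have h2 : t * (2 * (t + 1))⁻¹ ≤ 1 / 2 := by
    rw [← div_eq_mul_inv, div_le_iff₀ hpos]
    linarith
  linarith


omit [∀ i, Fintype (X i)] [∀ i, DecidableEq (X i)] [∀ i, Fintype (Y i)] [∀ i, Fintype (Z i)] [∀ i, Fintype (W i)]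
  [∀ i, Fintype (geo i).Site] [∀ i, DecidableEq (geo i).Site] in
/-- The six (3.46) lines from the three proved ones (n = 0, 1, 2) and the three displayed ones (n ≧ 3) (the bookkeeping of n06-k's
`B9RWSums346Schur`). [cite: Balaban1985BackgroundPropagators, (3.46) p.398 (bookkeeping)] -/
private theorem l2Block_of_split {i : I} {K : B9.KernelFamily (geo i) (bg i)} {U : (bg i).Cfg} {B₀ δ₀ : ℝ}
    (h0 : ∀ (lam : (geo i).Loc) (h : (geo i).Cut) (y y' : (geo i).Site), (geo i).cutIn h y → (geo i).suppIn lam y' →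
      K.l2 0 U lam h ≤ B₀ * B9.pref6 ((geo i).len y) 0 * (geo i).cutSup h * Real.exp (-(δ₀ * (geo i).dist y y')) * (geo i).l2Norm lam)
    (h1 : ∀ (lam : (geo i).Loc) (h : (geo i).Cut) (y y' : (geo i).Site), (geo i).cutIn h y → (geo i).suppIn lam y' →
      K.l2 1 U lam h ≤ B₀ * B9.pref6 ((geo i).len y) 1 * (geo i).cutSup h * Real.exp (-(δ₀ * (geo i).dist y y')) * (geo i).l2Norm lam)
    (h2 : ∀ (lam : (geo i).Loc) (h : (geo i).Cut) (y y' : (geo i).Site), (geo i).cutIn h y → (geo i).suppIn lam y' →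
      K.l2 2 U lam h ≤ B₀ * B9.pref6 ((geo i).len y) 2 * (geo i).cutSup h * Real.exp (-(δ₀ * (geo i).dist y y')) * (geo i).l2Norm lam)
    (h345 : ∀ (n : Fin 6), 3 ≤ n.val → ∀ (lam : (geo i).Loc) (h : (geo i).Cut) (y y' : (geo i).Site), (geo i).cutIn h y →
      (geo i).suppIn lam y' →
      K.l2 n U lam h ≤ B₀ * B9.pref6 ((geo i).len y) n * (geo i).cutSup h * Real.exp (-(δ₀ * (geo i).dist y y')) * (geo i).l2Norm lam) :
    L2Block K B₀ δ₀ U := by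
  intro n
  fin_cases n
  · exact h0
  · exact h1
  · exact h2
  · exact h345 3 (by decide)
  · exact h345 4 (by decide)
  · exact h345 5 (by decide)

/-- ★ **THEOREM 3.13 AS THE WHOLE PRINTED LEAF `B9.Thm313Printed`, AT THE PINS OF THEOREM 3.12 — THE L² LINES (3.46)₀,₁,₂ OF 𝔊 PROVED INSIDE**
(p. 426).  Inputs: those of `B9Thm313WholeLeafRel.thm313Printed_of_stepRel` plus `hα0 hα1` (0 ≦ α < 1), the transposition letters `hsymGG` (𝔊 symmetric,
(3.153)), `htrGG` ((∇_U𝔊)ᵀ = 𝔊∇\*_U), and n06-k's relative L² co-readings `hl2R` of `GG.l2 0∕1∕2` by 𝔊, ∇_U𝔊, 𝔊∇\*_U; `hres` now displays only the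
lines (3.46)ₙ, n ≧ 3, and the Hölder block of 𝔊.  PROVED INSIDE: (3.42)₁,₂,₃, (3.46)₀,₁,₂ (Schur + scale transfer + `l2line_of_blockBd_rel`, constant
m²·C_sup·L_c⁴, rate (1 − α)ρ′), (3.47)₀,₁,₂ of 𝔊, the pins.  Nothing of print asserted; NOT a node discharge.
[cite: Balaban1985BackgroundPropagators, Thm 3.13 p.426 + (3.152)–(3.153) p.426 + (3.138) p.423 + (3.41)–(3.42) p.397 + (3.46)–(3.47) p.398 + p.391; Balaban1984PropagatorsII, (2.51)–(2.52) p.232 + Lemma 2.1 (2.60)–(2.61) p.234] -/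
theorem thm313Printed_of_stepRelS (𝔬 : ∀ i, Ops (geo i) (bg i) (X i) (Y i) (Z i) (W i)) (R₀ : I → ℝ) (H₀ : I → Prop)
    (GG : ∀ i, B9.KernelFamily (geo i) (bg i)) (bH : ∀ i, BlockNorm (toB6 (geo i) (R₀ i) (H₀ i)) (W i → ℝ))
    (ev : ∀ i, (geo i).Loc → X i → ℝ) (evY : ∀ i, (geo i).Loc → Y i → ℝ) {P : ∀ i, (geo i).Loc → Prop}
    (Rel : ∀ i, (geo i).Site → (geo i).Site → Prop) [∀ i, DecidableRel (Rel i)] (m : ℕ)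
    (θ₁ θD r₁ B₀ δ₀ δK σ c ρ a₁ M₁ ML B₁ δ₁ B₃ δ₃ ρ' α Lc κ₀ : ℝ) (Bβ Bε : ℝ → ℝ) (Bεβ : ℝ → ℝ → ℝ)
    (hθ₁ : 0 ≤ θ₁) (hθD : 0 ≤ θD) (hr₁ : 0 ≤ r₁) (hB₀ : 0 ≤ B₀) (hB₃ : 0 ≤ B₃) (hσ : 0 ≤ σ) (hρ' : 0 < ρ') (hρ'ρ : ρ' + 3 * σ ≤ ρ)
    (hρS : ρ ≤ δ₀) (hρ₃ : ρ ≤ δ₃) (hρδ : ρ + σ ≤ δK) (hc : 0 ≤ c) (ha₁ : 0 < a₁) (hM₁ : 0 < M₁) (hδ₁ : 0 < δ₁)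
    (hα0 : 0 ≤ α) (hα1 : α < 1) (hBβ : ∀ β, 0 ≤ Bβ β) (hBε : ∀ ε, 0 ≤ Bε ε) (hBεβ : ∀ ε β, 0 ≤ Bεβ ε β)
    (hgeo : ∀ i, GeoOK (geo i)) (S : ∀ i, ModelSignsOn (geo i) (P i))
    (hL1 : ∀ i, 1 ≤ (geo i).L) (hLle : ∀ i, (geo i).L ≤ Lc) (hη : ∀ i, 0 < (geo i).eta) (hκ : ∀ i, (bH i).κ ≤ κ₀)
    (hrow : ∀ i, ML ≤ (geo i).M → RowSum (toB6 (geo i) (R₀ i) (H₀ i)) σ c)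
    (hL21 : ∀ δ : ℝ, 0 < δ → ∃ ML' c' : ℝ, Lemma21AboveG geo R₀ H₀ δ α ML' c')
    (hsat : ∀ (i : I) (n : Fin 4) (B' δ' : ℝ),
      (∀ a a' b, Rel i a a' → maj342 (geo i) n B' δ' a b = maj342 (geo i) n B' δ' a' b) ∧
      (∀ a b b', Rel i b b' → maj342 (geo i) n B' δ' a b = maj342 (geo i) n B' δ' a b'))
    (hmult : ∀ (i : I) (y' : (geo i).Site), (Finset.univ.filter (fun y'' => Rel i y'' y')).card ≤ m)
    (hcoR : ∀ (i : I) (U : (bg i).Cfg),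
      CoRealizesRel (GG i) 0 U (Rel i) (𝔬 i).blk (𝔬 i).blk (ev i) ((𝔬 i).GG U) ∧
      CoRealizesRel (GG i) 2 U (Rel i) (𝔬 i).blk (𝔬 i).blkY (evY i) ((𝔬 i).GG U ∘ₗ (𝔬 i).Dstar U))
    (hco1R : ∀ (i : I) (U : (bg i).Cfg), CoRealizesRel (GG i) 1 U (Rel i) (𝔬 i).blkY (𝔬 i).blk (ev i) ((𝔬 i).D U ∘ₗ (𝔬 i).GG U))
    (hcoG : ∀ (i : I) (U : (bg i).Cfg),
      CoReadsGlob (GG i) 0 U (𝔬 i).blk (𝔬 i).blk (ev i) ((𝔬 i).GG U) ∧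
      CoReadsGlob (GG i) 1 U (𝔬 i).blkY (𝔬 i).blk (ev i) ((𝔬 i).D U ∘ₗ (𝔬 i).GG U) ∧
      CoReadsGlob (GG i) 2 U (𝔬 i).blk (𝔬 i).blkY (evY i) ((𝔬 i).GG U ∘ₗ (𝔬 i).Dstar U))
    (hsymGG : ∀ (i : I) (U : (bg i).Cfg), IsTransposePair ((𝔬 i).GG U) ((𝔬 i).GG U))
    (htrGG : ∀ (i : I) (U : (bg i).Cfg), IsTransposePair ((𝔬 i).D U ∘ₗ (𝔬 i).GG U) ((𝔬 i).GG U ∘ₗ (𝔬 i).Dstar U))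
    (hl2R : ∀ (i : I) (U : (bg i).Cfg),
      L2ReadsRel (R := R₀ i) (H := H₀ i) (GG i) 0 U (Rel i) (𝔬 i).blk (𝔬 i).blk (ev i) ((𝔬 i).GG U) ∧
      L2ReadsRel (R := R₀ i) (H := H₀ i) (GG i) 1 U (Rel i) (𝔬 i).blkY (𝔬 i).blk (ev i) ((𝔬 i).D U ∘ₗ (𝔬 i).GG U) ∧
      L2ReadsRel (R := R₀ i) (H := H₀ i) (GG i) 2 U (Rel i) (𝔬 i).blk (𝔬 i).blkY (evY i) ((𝔬 i).GG U ∘ₗ (𝔬 i).Dstar U))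
    (hRdist : ∀ (i : I) (a a' b : (geo i).Site), Rel i a a' → (geo i).dist a b = (geo i).dist a' b)
    (hRdist' : ∀ (i : I) (a b b' : (geo i).Site), Rel i b b' → (geo i).dist a b = (geo i).dist a b')
    (hRlen : ∀ (i : I) (a a' : (geo i).Site), Rel i a a' → (geo i).len a = (geo i).len a')
    (hmodel : ∀ i, M₁ ≤ (geo i).M → ∀ α₀ : ℝ, 0 < α₀ → (geo i).M * α₀ ≤ a₁ →
      ∀ U : (bg i).Cfg, (bg i).Reg335 c35 α₀ U → (bg i).Reg336 c35 α₀ U →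
        Thm33G0 (𝔬 i) (R₀ i) (H₀ i) B₀ δ₀ U ∧
        Step (𝔬 i) (R₀ i) (H₀ i) (hgeo i).lenle 1 (θ₁ * ((geo i).M * α₀)) δK U ∧
        Step (𝔬 i) (R₀ i) (H₀ i) (hgeo i).lenle 2 (θ₁ * ((geo i).M * α₀)) δK U ∧
        FormSmall (𝔬 i) (r₁ * ((geo i).M * α₀)) U ∧ Identities (𝔬 i) U)
    (hleft : ∀ i, M₁ ≤ (geo i).M → ∀ α₀ : ℝ, 0 < α₀ → (geo i).M * α₀ ≤ a₁ →
      ∀ U : (bg i).Cfg, (bg i).Reg335 c35 α₀ U → (bg i).Reg336 c35 α₀ U →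
        LeftStep (𝔬 i) (R₀ i) (H₀ i) (hgeo i).lenle B₀ δ₀ (θD * ((geo i).M * α₀)) δK U)
    (hletters : ∀ i, M₁ ≤ (geo i).M → ∀ α₀ : ℝ, 0 < α₀ → (geo i).M * α₀ ≤ a₁ →
      ∀ U : (bg i).Cfg, (bg i).Reg335 c35 α₀ U → (bg i).Reg336 c35 α₀ U →
        Letters313 (𝔬 i) (R₀ i) (H₀ i) (hgeo i) B₃ δ₃ U)
    (hlettersD : ∀ i, M₁ ≤ (geo i).M → ∀ α₀ : ℝ, 0 < α₀ → (geo i).M * α₀ ≤ a₁ →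
      ∀ U : (bg i).Cfg, (bg i).Reg335 c35 α₀ U → (bg i).Reg336 c35 α₀ U →
        Letters313D (𝔬 i) (R₀ i) (H₀ i) (hgeo i) B₃ δ₃ (bH i) U)
    (hres : ∀ i, M₁ ≤ (geo i).M → ∀ α₀ : ℝ, 0 < α₀ → (geo i).M * α₀ ≤ a₁ →
      ∀ U : (bg i).Cfg, (bg i).Reg335 c35 α₀ U → (bg i).Reg336 c35 α₀ U →
        (∀ (n : Fin 6), 3 ≤ n.val → ∀ (lam : (geo i).Loc) (h : (geo i).Cut) (y y' : (geo i).Site), (geo i).cutIn h y →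
          (geo i).suppIn lam y' →
          (GG i).l2 n U lam h ≤ B₁ * B9.pref6 ((geo i).len y) n * (geo i).cutSup h * Real.exp (-(δ₁ * (geo i).dist y y')) *
            (geo i).l2Norm lam) ∧
        B9.Ineq343_345 (GG i) Bβ Bε Bεβ δ₁ U) :
    B9.Thm313Printed c35 geo bg GG (fun i => HasRWExpOfOps (𝔬 i)) (fun i => PosDefKOfOps (𝔬 i)) := by
  -- the constants of the leaf
  obtain ⟨MLg, cg, hLg⟩ := hL21 ρ' hρ'
  set cg' : ℝ := max cg 0 with hcg'
  have hcg'0 : 0 ≤ cg' := le_max_right _ _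
  set a₀ : ℝ := min a₁ (min (2 * (θ₁ * c + 1))⁻¹ (2 * (r₁ + 1))⁻¹) with ha₀
  set C₂ : ℝ := const313 (2 * B₀) (2 * B₃) B₃ c with hC₂
  set CD : ℝ := constD313 (B₀ + θD * a₁ * (2 * B₀) * c) (θD * a₁) (2 * B₀) (2 * B₃) B₃ (max κ₀ 0) c with hCD
  set Csup : ℝ := max C₂ CD with hCsup
  set CsupR : ℝ := (m : ℝ) * Csup with hCsupR
  set Cgl : ℝ := Csup * cg' * Lc ^ (4 : ℝ) with hCgl
  set Λu : ℝ := Lc ^ (4 : ℝ) with hΛu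
  set BL2S : ℝ := (m : ℝ) * m * (Csup * Λu) with hBL2S
  set Bout : ℝ := max (max (max (max CsupR Cgl) B₁) BL2S) 1 with hBout
  set δout : ℝ := min ((1 - α) * ρ') δ₁ with hδout
  have ha₀pos : 0 < a₀ := lt_min ha₁ (lt_min (inv_pos.mpr (by nlinarith)) (inv_pos.mpr (by linarith)))
  have hC₂0 : 0 ≤ C₂ := const313_nonneg (by linarith) (by linarith) hB₃ hc
  have hCsup2 : C₂ ≤ Csup := le_max_left _ _
  have hCsupD : CD ≤ Csup := le_max_right _ _
  have hCsup0 : 0 ≤ Csup := hC₂0.trans hCsup2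
  have hCsupR0 : 0 ≤ CsupR := mul_nonneg (Nat.cast_nonneg m) hCsup0
  have hBoutS : CsupR ≤ Bout := (((le_max_left _ _).trans (le_max_left _ _)).trans (le_max_left _ _)).trans (le_max_left _ _)
  have hBoutG : Cgl ≤ Bout := (((le_max_right _ _).trans (le_max_left _ _)).trans (le_max_left _ _)).trans (le_max_left _ _)
  have hBoutB₁ : B₁ ≤ Bout := ((le_max_right _ _).trans (le_max_left _ _)).trans (le_max_left _ _)
  have hBoutL : BL2S ≤ Bout := (le_max_right _ _).trans (le_max_left _ _)
  have hBout0 : 0 ≤ Bout := zero_le_one.trans (le_max_right _ _)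
  have h1α : 0 < 1 - α := by linarith
  have hαρ : 0 ≤ α * ρ' := mul_nonneg hα0 hρ'.le
  have hδρ1 : δout ≤ (1 - α) * ρ' := min_le_left _ _
  have hδρ : δout ≤ ρ' := hδρ1.trans (by nlinarith)
  have hδδ₁ : δout ≤ δ₁ := min_le_right _ _
  refine ⟨max (max M₁ ML) MLg, δout, a₀, Bout, Bβ, Bε, Bεβ, lt_max_of_lt_left (lt_max_of_lt_left hM₁), lt_min (by positivity) hδ₁,
    ha₀pos, zero_lt_one.trans_le (le_max_right _ _), ?_⟩
  intro i hM α₀ hα₀ hMa U hU hU'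
  have hM₁i : M₁ ≤ (geo i).M := ((le_max_left _ _).trans (le_max_left _ _)).trans hM
  have hMLi : ML ≤ (geo i).M := ((le_max_right _ _).trans (le_max_left _ _)).trans hM
  have hMLgi : MLg ≤ (geo i).M := (le_max_right _ _).trans hM
  have hMpos : 0 < (geo i).M := hM₁.trans_le hM₁i
  have hm0 : 0 ≤ (geo i).M * α₀ := (mul_pos hMpos hα₀).le
  have hma₁ : (geo i).M * α₀ ≤ a₁ := hMa.trans (min_le_left _ _)
  have hmθ : (geo i).M * α₀ ≤ (2 * (θ₁ * c + 1))⁻¹ := hMa.trans ((min_le_right _ _).trans (min_le_left _ _))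
  have hmr : (geo i).M * α₀ ≤ (2 * (r₁ + 1))⁻¹ := hMa.trans ((min_le_right _ _).trans (min_le_right _ _))
  obtain ⟨h33, hS1, hS2, hF, hI⟩ := hmodel i hM₁i α₀ hα₀ hma₁ U hU hU'
  have hL := hletters i hM₁i α₀ hα₀ hma₁ U hU hU'
  have hLD := hlettersD i hM₁i α₀ hα₀ hma₁ U hU hU'
  have hLS := hleft i hM₁i α₀ hα₀ hma₁ U hU hU'
  obtain ⟨hl345, hho⟩ := hres i hM₁i α₀ hα₀ hma₁ U hU hU'
  obtain ⟨hlR0, hlR1, hlR2⟩ := hl2R i U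
  have hrowi := hrow i hMLi
  obtain ⟨h260, hrowg, hsize⟩ := hLg i hMLgi
  have hrowg' : RowSum (toB6 (geo i) (R₀ i) (H₀ i)) ((1 - α) * ρ') cg' := fun y => (hrowg y).trans (le_max_left _ _)
  set θ : ℝ := θ₁ * ((geo i).M * α₀) with hθdef
  set θ' : ℝ := θD * ((geo i).M * α₀) with hθ'def
  have hθ : 0 ≤ θ := mul_nonneg hθ₁ hm0
  have hθ' : 0 ≤ θ' := mul_nonneg hθD hm0
  have hq : θ * c ≤ 1 / 2 := by
    have h := small_aux₆ (mul_nonneg hθ₁ hc) hmθ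
    calc θ * c = θ₁ * c * ((geo i).M * α₀) := by rw [hθdef]; ring
      _ ≤ 1 / 2 := h
  have hq1 : θ * c < 1 := lt_one_of_le_half hq
  have hr : r₁ * ((geo i).M * α₀) < 1 := by
    have h := small_aux₆ hr₁ hmr
    linarith
  have hσδ : σ ≤ δK := by linarith
  have hinv0 : 0 ≤ (1 - θ * c)⁻¹ := inv_nonneg.mpr (by linarith)
  have hA₁ : 0 ≤ B₀ * (1 - θ * c)⁻¹ := mul_nonneg hB₀ hinv0
  have hA₃ : 0 ≤ B₃ * (1 - θ * c)⁻¹ := mul_nonneg hB₃ hinv0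
  have hA₁le : B₀ * (1 - θ * c)⁻¹ ≤ 2 * B₀ := const_le_two_mul hB₀ hq
  have hA₃le : B₃ * (1 - θ * c)⁻¹ ≤ 2 * B₃ := const_le_two_mul hB₃ hq
  have hC0 : 0 ≤ const313 (B₀ * (1 - θ * c)⁻¹) (B₃ * (1 - θ * c)⁻¹) B₃ c := const313_nonneg hA₁ hA₃ hB₃ hc
  have hCle : const313 (B₀ * (1 - θ * c)⁻¹) (B₃ * (1 - θ * c)⁻¹) B₃ c ≤ Csup :=
    (const313_mono hA₁ hA₁le hA₃ hA₃le hB₃ hc).trans hCsup2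
  -- the constant of the left entry
  have hCL : 0 ≤ B₀ + θ' * (B₀ * (1 - θ * c)⁻¹) * c := add_nonneg hB₀ (mul_nonneg (mul_nonneg hθ' hA₁) hc)
  have hθ'le : θ' ≤ θD * a₁ := mul_le_mul_of_nonneg_left hma₁ hθD
  have hCLle : B₀ + θ' * (B₀ * (1 - θ * c)⁻¹) * c ≤ B₀ + θD * a₁ * (2 * B₀) * c := by
    have h2 : θ' * (B₀ * (1 - θ * c)⁻¹) ≤ θD * a₁ * (2 * B₀) := mul_le_mul hθ'le hA₁le hA₁ (mul_nonneg hθD ha₁.le)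
    have h3 : θ' * (B₀ * (1 - θ * c)⁻¹) * c ≤ θD * a₁ * (2 * B₀) * c := mul_le_mul_of_nonneg_right h2 hc
    linarith
  have hD0 : 0 ≤ constD313 (B₀ + θ' * (B₀ * (1 - θ * c)⁻¹) * c) θ' (B₀ * (1 - θ * c)⁻¹) (B₃ * (1 - θ * c)⁻¹) B₃ (bH i).κ c :=
    constD313_nonneg hCL hθ' hA₁ hA₃ hB₃ (bH i).κ_nonneg hc
  have hDle : constD313 (B₀ + θ' * (B₀ * (1 - θ * c)⁻¹) * c) θ' (B₀ * (1 - θ * c)⁻¹) (B₃ * (1 - θ * c)⁻¹) B₃ (bH i).κ c ≤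
      Csup :=
    (constD313_mono hCLle hθ' hθ'le hA₁ hA₁le hA₃ hA₃le hB₃ ((hκ i).trans (le_max_left _ _)) hc).trans hCsupD
  obtain ⟨hco0, hco2⟩ := hcoR i U
  have hco1i := hco1R i U
  obtain ⟨hg0, hg1, hg2⟩ := hcoG i U
  have hlen := (hgeo i).lenle
  -- the model majorants of 𝔊 at the rate ρ′
  have hm0 := GG_entry0_of_letters (hgeo i) hrowi hc hθ hB₀ hB₃ hσ hρ'.le hρ'ρ hρS hρ₃ hρδ hq1 hS2.step1 h33.e0 hL hI
  have hm1 := GG_entry1_of_letters (hgeo i) hrowi hc hθ hθ' hB₀ hB₃ hσ hρ'.le hρ'ρ hρS hρ₃ hρδ hq1 hS2.step1 h33.e0 hLS hL hLD hI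
  have hm2 := GG_entry2_of_letters (hgeo i) hrowi hc hθ hB₀ hB₃ hσ hρ'.le hρ'ρ hρS hρ₃ hρδ hq1 hS1.step1 h33.e2 hL hI
  -- the same majorants in the `maj342 · n Csup ρ′` shape, for the (3.47) passage on the model lattice
  have hM0 : HasMajorantHom (g := toB6 (geo i) (R₀ i) (H₀ i)) (𝔬 i).blk (𝔬 i).blk ((𝔬 i).GG U) (maj342 (geo i) 0 Csup ρ') :=
    hasMajorantHom_maj342_zero_of_le ((hasMajorantHom_iff (g := toB6 (geo i) (R₀ i) (H₀ i)) (𝔬 i).blk _ _).2 hm0) hCle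
  have hM1 : HasMajorantHom (g := toB6 (geo i) (R₀ i) (H₀ i)) (𝔬 i).blk (𝔬 i).blkY ((𝔬 i).D U ∘ₗ (𝔬 i).GG U) (maj342 (geo i) 1 Csup ρ') :=
    hasMajorantHom_maj342_one_of_le hm1 hDle hlen
  have hM2 : HasMajorantHom (g := toB6 (geo i) (R₀ i) (H₀ i)) (𝔬 i).blkY (𝔬 i).blk ((𝔬 i).GG U ∘ₗ (𝔬 i).Dstar U) (maj342 (geo i) 2 Csup ρ') :=
    hasMajorantHom_maj342_two_of_le hm2 hCle hlen
  -- the proved clauses (3.42)₁,₂,₃ of 𝔊 at the rate ρ′ with the constant m·Csup, through the RELATIVE co-readings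
  have cl0 : Clause342 (GG i) 0 CsupR ρ' U :=
    clause342_of_hasMajorantHom_rel hco0 hCsup0 hlen (hsat i 0 Csup ρ').1 (hsat i 0 Csup ρ').2 (hmult i) hM0
  have cl1 : Clause342 (GG i) 1 CsupR ρ' U :=
    clause342_of_hasMajorantHom_rel hco1i hCsup0 hlen (hsat i 1 Csup ρ').1 (hsat i 1 Csup ρ').2 (hmult i) hM1
  have cl2 : Clause342 (GG i) 2 CsupR ρ' U :=
    clause342_of_hasMajorantHom_rel hco2 hCsup0 hlen (hsat i 2 Csup ρ').1 (hsat i 2 Csup ρ').2 (hmult i) hM2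
  -- the global entries (3.47)₀,₁,₂ of 𝔊, constant Csup·c′·L⁴ ≦ Bout
  have hL0i : 0 < (geo i).L := lt_of_lt_of_le one_pos (hL1 i)
  have hL4 : (geo i).L ^ (4 : ℝ) ≤ Lc ^ (4 : ℝ) := Real.rpow_le_rpow hL0i.le (hLle i) (by norm_num)
  have hCgl0 : 0 ≤ Csup * cg' * (geo i).L ^ (4 : ℝ) := mul_nonneg (mul_nonneg hCsup0 hcg'0) (Real.rpow_nonneg hL0i.le _)
  have hCglle : Csup * cg' * (geo i).L ^ (4 : ℝ) ≤ Bout := (mul_le_mul_of_nonneg_left hL4 (mul_nonneg hCsup0 hcg'0)).trans hBoutG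
  have hglob : ∀ (n : Fin 4) (lam : (geo i).Loc) (γ : ℝ), n ≠ 3 → -4 ≤ γ → γ ≤ 4 →
      (GG i).glob n U lam γ ≤ Bout * (geo i).wNorm γ lam :=
    glob_noLap_of_entries (PG := fun _ => True) (S i) hCgl0 hCgl0 hCgl0 hCglle hCglle hCglle
      (fun lam γ _ => glob_of_hasMajorantHom hg0 hM0 hCsup0 hcg'0 (hL1 i) (hη i) (S i).wNorm_nonneg hsize h260 hrowg' lam γ)
      (fun lam γ _ => glob_of_hasMajorantHom hg1 hM1 hCsup0 hcg'0 (hL1 i) (hη i) (S i).wNorm_nonneg hsize h260 hrowg' lam γ)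
      (fun lam γ _ => glob_of_hasMajorantHom hg2 hM2 hCsup0 hcg'0 (hL1 i) (hη i) (S i).wNorm_nonneg hsize h260 hrowg' lam γ)
      (fun _ _ _ h => absurd trivial h)
  -- everything brought to (Bout, δout)
  have w : ∀ {j : Fin 4}, Clause342 (GG i) j CsupR ρ' U → Clause342 (GG i) j Bout δout U := fun cm =>
    clause342_mono cm hCsupR0 hBoutS hδρ (S i).dist_nonneg hlen (S i).supNorm_nonneg
  -- the L² lines (3.46)₀,₁,₂ of 𝔊 by the Schur test from the three sup majorants, the transposition letters and the scale transfer
  have hm00 : (0 : ℝ) ≤ m := Nat.cast_nonneg m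
  have hΛu0 : 0 ≤ Λu := Real.rpow_nonneg (hL0i.le.trans (hLle i)) _
  have hST : ∀ γ : ℝ, |γ| ≤ 4 → ScaleTransfer (geo i) ρ' α ((geo i).L ^ |γ|) (fun y => (geo i).len y ^ γ) ∧
      0 ≤ (geo i).L ^ |γ| ∧ (geo i).L ^ |γ| ≤ Λu := fun γ hγ =>
    ⟨scaleTransfer_rpow_of_260 h260 hsize (hL1 i) (hη i) γ hγ, Real.rpow_nonneg hL0i.le _,
      (B9Ineq347AllEntries.size_condition_compact (geo i).L γ _ (hL1 i) hγ hsize).2.trans hL4⟩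
  obtain ⟨hST1, hΛ₁0, hΛ₁le⟩ := hST 1 (by norm_num)
  obtain ⟨hSTh, hΛh0, hΛhle⟩ := hST (1 / 2) (by rw [abs_of_nonneg (by norm_num : (0 : ℝ) ≤ 1 / 2)]; norm_num)
  have hb0 := l2bd_entry0_of_sup (R₀ := R₀ i) (H₀ := H₀ i) (hgeo i) hC0 hST1 hm0 (hsymGG i U)
  have hm1' : HasMajorantHom (g := toB6 (geo i) (R₀ i) (H₀ i)) (𝔬 i).blk (𝔬 i).blkY ((𝔬 i).D U ∘ₗ (𝔬 i).GG U)
      (fun (a b : (geo i).Site) => Csup * (geo i).len a * Real.exp (-(ρ' * (geo i).dist a b))) :=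
    hasMajorantHom_mono (g := toB6 (geo i) (R₀ i) (H₀ i)) (𝔬 i).blk (𝔬 i).blkY hm1 fun a b =>
      mul_le_mul_of_nonneg_right (mul_le_mul_of_nonneg_right hDle (hlen a)) (Real.exp_nonneg _)
  have hm2' : HasMajorantHom (g := toB6 (geo i) (R₀ i) (H₀ i)) (𝔬 i).blkY (𝔬 i).blk ((𝔬 i).GG U ∘ₗ (𝔬 i).Dstar U)
      (fun (a b : (geo i).Site) => Csup * (geo i).len a * Real.exp (-(ρ' * (geo i).dist a b))) :=
    hasMajorantHom_mono (g := toB6 (geo i) (R₀ i) (H₀ i)) (𝔬 i).blkY (𝔬 i).blk hm2 fun a b =>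
      mul_le_mul_of_nonneg_right (mul_le_mul_of_nonneg_right hCle (hlen a)) (Real.exp_nonneg _)
  obtain ⟨hb1, hb2⟩ := l2bd_entry12_of_sup (R₀ := R₀ i) (H₀ := H₀ i) (hgeo i) hCsup0 hSTh hm1' hm2' (htrGG i U)
  have hexp : ∀ y y' : (geo i).Site, Real.exp (-((1 - α) * ρ' * (geo i).dist y y')) ≤ Real.exp (-(δout * (geo i).dist y y')) :=
    fun y y' => Real.exp_le_exp.mpr (neg_le_neg (mul_le_mul_of_nonneg_right hδρ1 ((S i).dist_nonneg y y')))
  have hKL0 : 0 ≤ Csup * Λu := mul_nonneg hCsup0 hΛu0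
  have hK0le : const313 (B₀ * (1 - θ * c)⁻¹) (B₃ * (1 - θ * c)⁻¹) B₃ c * (geo i).L ^ |(1 : ℝ)| ≤ Csup * Λu :=
    mul_le_mul hCle hΛ₁le hΛ₁0 hCsup0
  have hKhle : Csup * (geo i).L ^ |(1 / 2 : ℝ)| ≤ Csup * Λu := mul_le_mul_of_nonneg_left hΛhle hCsup0
  have hP : ∀ t : ℝ, B9.pref6 t 0 = t ^ 2 ∧ B9.pref6 t 1 = t ∧ B9.pref6 t 2 = t := fun t => by simp [B9.pref6]
  have hB0 : BlockBd (g := toB6 (geo i) (R₀ i) (H₀ i)) (𝔬 i).blk (𝔬 i).blk ((𝔬 i).GG U)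
      (fun (y y' : (geo i).Site) => Csup * Λu * B9.pref6 ((geo i).len y) 0 * Real.exp (-(δout * (geo i).dist y y'))) := by
    refine hb0.mono fun y y' => ?_
    rw [(hP ((geo i).len y)).1]
    calc const313 (B₀ * (1 - θ * c)⁻¹) (B₃ * (1 - θ * c)⁻¹) B₃ c * (geo i).L ^ |(1 : ℝ)| * (geo i).len y ^ 2 *
          Real.exp (-((1 - α) * ρ' * (geo i).dist y y'))
        ≤ Csup * Λu * (geo i).len y ^ 2 * Real.exp (-((1 - α) * ρ' * (geo i).dist y y')) :=
          mul_le_mul_of_nonneg_right (mul_le_mul_of_nonneg_right hK0le (sq_nonneg _)) (Real.exp_nonneg _)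
      _ ≤ Csup * Λu * (geo i).len y ^ 2 * Real.exp (-(δout * (geo i).dist y y')) :=
          mul_le_mul_of_nonneg_left (hexp y y') (mul_nonneg hKL0 (sq_nonneg _))
  have hB1 : BlockBd (g := toB6 (geo i) (R₀ i) (H₀ i)) (𝔬 i).blk (𝔬 i).blkY ((𝔬 i).D U ∘ₗ (𝔬 i).GG U)
      (fun (y y' : (geo i).Site) => Csup * Λu * B9.pref6 ((geo i).len y) 1 * Real.exp (-(δout * (geo i).dist y y'))) := by
    refine hb1.mono fun y y' => ?_
    rw [(hP ((geo i).len y)).2.1]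
    calc Csup * (geo i).L ^ |(1 / 2 : ℝ)| * (geo i).len y * Real.exp (-((1 - α) * ρ' * (geo i).dist y y'))
        ≤ Csup * Λu * (geo i).len y * Real.exp (-((1 - α) * ρ' * (geo i).dist y y')) :=
          mul_le_mul_of_nonneg_right (mul_le_mul_of_nonneg_right hKhle (hlen y)) (Real.exp_nonneg _)
      _ ≤ Csup * Λu * (geo i).len y * Real.exp (-(δout * (geo i).dist y y')) :=
          mul_le_mul_of_nonneg_left (hexp y y') (mul_nonneg hKL0 (hlen y))
  have hB2 : BlockBd (g := toB6 (geo i) (R₀ i) (H₀ i)) (𝔬 i).blkY (𝔬 i).blk ((𝔬 i).GG U ∘ₗ (𝔬 i).Dstar U)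
      (fun (y y' : (geo i).Site) => Csup * Λu * B9.pref6 ((geo i).len y) 2 * Real.exp (-(δout * (geo i).dist y y'))) := by
    refine hb2.mono fun y y' => ?_
    rw [(hP ((geo i).len y)).2.2]
    calc Csup * (geo i).L ^ |(1 / 2 : ℝ)| * (geo i).len y * Real.exp (-((1 - α) * ρ' * (geo i).dist y y'))
        ≤ Csup * Λu * (geo i).len y * Real.exp (-((1 - α) * ρ' * (geo i).dist y y')) :=
          mul_le_mul_of_nonneg_right (mul_le_mul_of_nonneg_right hKhle (hlen y)) (Real.exp_nonneg _)
      _ ≤ Csup * Λu * (geo i).len y * Real.exp (-(δout * (geo i).dist y y')) :=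
          mul_le_mul_of_nonneg_left (hexp y y') (mul_nonneg hKL0 (hlen y))
  have hl0 := l2line_of_blockBd_rel hlR0 (hRlen i) (hRdist i) (hRdist' i) (hmult i) hKL0 hlen hB0
  have hl1 := l2line_of_blockBd_rel hlR1 (hRlen i) (hRdist i) (hRdist' i) (hmult i) hKL0 hlen hB1
  have hl2 := l2line_of_blockBd_rel hlR2 (hRlen i) (hRdist i) (hRdist' i) (hmult i) hKL0 hlen hB2
  -- everything brought to (Bout, δout)
  have w5 : ∀ {n : Fin 6} {b δ : ℝ}, b ≤ Bout → δout ≤ δ →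
      (∀ (lam : (geo i).Loc) (h : (geo i).Cut) (y y' : (geo i).Site), (geo i).cutIn h y → (geo i).suppIn lam y' →
        (GG i).l2 n U lam h ≤ b * B9.pref6 ((geo i).len y) n * (geo i).cutSup h * Real.exp (-(δ * (geo i).dist y y')) *
          (geo i).l2Norm lam) →
      ∀ (lam : (geo i).Loc) (h : (geo i).Cut) (y y' : (geo i).Site), (geo i).cutIn h y → (geo i).suppIn lam y' →
        (GG i).l2 n U lam h ≤ Bout * B9.pref6 ((geo i).len y) n * (geo i).cutSup h * Real.exp (-(δout * (geo i).dist y y')) *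
          (geo i).l2Norm lam := by
    intro n b δ hb hδ h lam hc y y' hcut hs
    exact weaken5 (h lam hc y y' hcut hs) hb hBout0 (pref6_nonneg (hlen y) n) ((S i).cutSup_nonneg hc) ((S i).l2Norm_nonneg lam)
      hδ ((S i).dist_nonneg y y')
  have hl2B : L2Block (GG i) Bout δout U :=
    l2Block_of_split (w5 hBoutL le_rfl hl0) (w5 hBoutL le_rfl hl1) (w5 hBoutL le_rfl hl2)
      (fun n hn => w5 hBoutB₁ hδδ₁ (hl345 n hn))
  exact ⟨⟨eNoLap_of_clauses (w cl0) (w cl1) (w cl2), hl2B, hglob⟩,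
    ineq343_345_mono (S i) hho (fun _ => le_rfl) hBβ (fun _ => le_rfl) hBε (fun _ _ => le_rfl) hBεβ hδδ₁,
    hasRWExp_of_schemas (hgeo i) hrowi hθ hσδ hq1 hS2 hI (GG i) δout, posDefK_of_schemas hr hF hI (GG i)⟩

end Family

end

end Literature.MathematicalPhysics.QuantumFieldTheory.Balaban1983to89.B9Thm313WholeLeafRelS
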